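import Summits.AtomisticToContinuum.FouriersLaw.Theses.JunctionLocality
import Summits.AtomisticToContinuum.FouriersLaw.Theses.SpatialCentreManifold
import Summits.AtomisticToContinuum.FouriersLaw.Theorems.OddSectorIrreversibilityBoundedResponseConvergesComonotoneComposition
import Summits.AtomisticToContinuum.FouriersLaw.Theorems.OddSectorIrreversibilityBoundedResponseConvergesStubLayerBounded
import Summits.AtomisticToContinuum.FouriersLaw.Theorems.OddSectorIrreversibilityBoundedResponseConvergesStubLengthMonotone

/-!
# Crux `BoundedResponseConverges` (stmt-AtomisticToContinuum-9141), line `comonotone-local-resistance`: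
# the conductance floor is inside S1 ∧ S3

Lead c3. KILL CRITERION for the line (card §Barriers, "not typed here", now typed and proved): the two registered stubs
S1 (`stub_inwardOrdering`: inward quasi-ordering of the local resistances on the hot half, finitely many contact bonds
exempt) and S3 (`stub_layerBounded`: every fixed-depth local resistance bounded uniformly in the length) ALONE imply the
sibling crux `JunctionLocality.ConductanceLowerBound` (stmt-AtomisticToContinuum-11749): by the series law
`(N−1)/D_N = 2/γ + Σ_b r_b^{(N)}` (landed contact identity) and reflection `r_b = r_{N−2−b}`, every bond is either one of the
`i₀` exempt contact bonds (bounded by S3) or dominated by the depth-`i₀` bond plus slack (S1), itself bounded (S3); hence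
`1/D_N ≤ 2/γ + K` eventually, `D_N ≥ c := 1/(2/γ + K + 1) > 0`. So an insulator point (`D_N → 0` with bounded response)
kills this line exactly as it kills the two-scale line (`Negative/TwoScaleKillCriteria`), and the floor that the
disprover's `skeleton_insulating_mode` demands is carried by S1 + S3, not by S2. COROLLARY (by name): since S1, S2, S3 are
all shadows of `SpatialCentreManifold.LocalFourierLaw` (stmt-13406; `stub_inwardOrdering_of_localFourierLaw`,
`stub_lengthMonotone_of_summableLayers`, `stub_layerBounded_of_localFourierLaw`), the landed composition gives
`boundedResponseConverges_of_localFourierLaw : LocalFourierLaw → BoundedResponseConverges` (stmt-13406 ⇒ stmt-9141).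
No definitions; standard axioms.
-/

noncomputable section

namespace Summit.AtomisticToContinuum.FouriersLaw.Cruxes.BoundedResponseConverges.ComonotoneLocalResistance.Stubs

open MeasureTheory Filter Topology
open Literature.MathematicalPhysics.KineticTheory.HeatConduction

/-- **S1 ∧ S3 ⇒ `JunctionLocality.ConductanceLowerBound` (stmt-11749)** — registered sub-goal
`conductanceLowerBound_of_inwardOrdering_of_layerBounded` of crux stmt-9141. See the module docstring. [folklore] -/
theorem conductanceLowerBound_of_inwardOrdering_of_layerBounded :
    (∀ ω₂ lam β γ : ℝ, 0 < ω₂ → 0 < lam → 0 < β → 0 < γ → (∀ (N : ℕ) (T_L T_R : ℝ), 0 < T_L → 0 < T_R → ∀ μ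
    ν : Measure (PhaseSpace N), (pinnedChain ω₂ lam β γ).IsSteadyState N T_L T_R μ → (pinnedChain ω₂ lam β
    γ).IsSteadyState N T_L T_R ν → μ = ν) → ∀ μ : (N : ℕ) → ℝ → ℝ → Measure (PhaseSpace N), (∀ (N : ℕ) (T_L
    T_R : ℝ), 0 < T_L → 0 < T_R → (pinnedChain ω₂ lam β γ).IsSteadyState N T_L T_R (μ N T_L T_R)) → ∀ T : ℝ,
    0 < T → ∃ N₀ i₀ : ℕ, ∃ s : ℕ → ℝ, Tendsto s atTop (𝓝 0) ∧ ∀ (N : ℕ) (θ : ℕ → ℝ) (d : ℝ), N₀ ≤ N → (∀ i :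
    Fin N, Tendsto (fun δ : ℝ => ((∫ x, (x.2 i) ^ 2 ∂(μ N (T + δ / 2) (T - δ / 2))) - ∫ x, (x.2 i) ^ 2 ∂(μ N
    T T)) / δ) (𝓝[≠] 0) (𝓝 (θ i))) → Tendsto (fun δ : ℝ => (pinnedChain ω₂ lam β γ).totalCurrent (μ N (T + δ
    / 2) (T - δ / 2)) / δ) (𝓝[≠] 0) (𝓝 d) → 0 < d → ∀ i j : ℕ, i₀ ≤ i → i ≤ j → 2 * j + 2 ≤ N → (θ j - θ (j
    + 1)) * (((N : ℝ) - 1) / d) ≤ (θ i - θ (i + 1)) * (((N : ℝ) - 1) / d) + s i) → (∀ ω₂ lam β γ : ℝ, 0 < ω₂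
    → 0 < lam → 0 < β → 0 < γ → (∀ (N : ℕ) (T_L T_R : ℝ), 0 < T_L → 0 < T_R → ∀ μ ν : Measure (PhaseSpace
    N), (pinnedChain ω₂ lam β γ).IsSteadyState N T_L T_R μ → (pinnedChain ω₂ lam β γ).IsSteadyState N T_L
    T_R ν → μ = ν) → ∀ μ : (N : ℕ) → ℝ → ℝ → Measure (PhaseSpace N), (∀ (N : ℕ) (T_L T_R : ℝ), 0 < T_L → 0 <
    T_R → (pinnedChain ω₂ lam β γ).IsSteadyState N T_L T_R (μ N T_L T_R)) → ∀ T : ℝ, 0 < T → ∀ j : ℕ, ∃ B :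
    ℝ, ∃ N₀ : ℕ, ∀ (N : ℕ) (θ : ℕ → ℝ) (d : ℝ), N₀ ≤ N → 2 * j + 2 ≤ N → (∀ i : Fin N, Tendsto (fun δ : ℝ =>
    ((∫ x, (x.2 i) ^ 2 ∂(μ N (T + δ / 2) (T - δ / 2))) - ∫ x, (x.2 i) ^ 2 ∂(μ N T T)) / δ) (𝓝[≠] 0) (𝓝 (θ
    i))) → Tendsto (fun δ : ℝ => (pinnedChain ω₂ lam β γ).totalCurrent (μ N (T + δ / 2) (T - δ / 2)) / δ)
    (𝓝[≠] 0) (𝓝 d) → 0 < d → |(θ j - θ (j + 1)) * (((N : ℝ) - 1) / d)| ≤ B) →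
    Summit.AtomisticToContinuum.FouriersLaw.Theses.JunctionLocality.ConductanceLowerBound := by
  intro h1 h3 ω₂ lam β γ hω hl hβ hγ hU μ hμ T hT D hD
  -- the response profiles θ N : ℕ → ℝ
  have hprof := fun N i =>
    Theorems.PuiseuxTransferLedgerFiniteResponseProfile.finiteResponseProfile_proof
      ω₂ lam β γ hω hl hβ hγ hU μ hμ T hT N i
  choose θF hθF using hprof
  set θ : ℕ → ℕ → ℝ := fun N i => if h : i < N then θF N ⟨i, h⟩ else 0 with hθdef
  have hθ : ∀ (N : ℕ) (i : Fin N), Tendsto (fun δ : ℝ =>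
      ((∫ x, (x.2 i) ^ 2 ∂(μ N (T + δ / 2) (T - δ / 2))) - ∫ x, (x.2 i) ^ 2 ∂(μ N T T)) / δ)
      (𝓝[≠] 0) (𝓝 (θ N i)) := by
    intro N i
    have e : θ N i = θF N i := by
      show (if h : (i : ℕ) < N then θF N ⟨i, h⟩ else 0) = θF N i
      rw [dif_pos i.isLt]
    rw [e]
    exact hθF N i
  -- positivity of the response and the contact identities
  have hpos : ∀ N, 2 ≤ N → 0 < D N :=
    TwoScaleGluingLogRigidity.Stubs.positiveConductance_holds ω₂ lam β γ hω hl hβ hγ hU μ hμ T hT D hD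
  have hci : ∀ (N : ℕ), 2 ≤ N →
      D N = γ * ((N : ℝ) - 1) * (1 / 2 - θ N 0) ∧ D N = γ * ((N : ℝ) - 1) * (θ N (N - 1) + 1 / 2) := by
    intro N hN
    exact Theorems.transferKernelPositivity_contactIdentity_proof ω₂ lam β γ hω hl hβ hγ hU μ hμ T hT N hN
      (θ N 0) (θ N (N - 1)) (D N) (hθ N ⟨0, by omega⟩) (hθ N ⟨N - 1, by omega⟩) (hD N)
  have hanti : ∀ (N i : ℕ), i < N → θ N (N - 1 - i) = -θ N i :=
    fun N i hi => responseProfile_reflect hU hμ hT (hθ N) i hi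
  -- local resistances and the bath-to-bath resistance
  set r : ℕ → ℕ → ℝ := fun N b => (θ N b - θ N (b + 1)) * (((N : ℝ) - 1) / D N) with hrdef
  have hledger : ∀ N : ℕ, 2 ≤ N → ((N : ℝ) - 1) / D N = 2 / γ + ∑ b ∈ Finset.range (N - 1), r N b := by
    intro N hN
    obtain ⟨h0, h1'⟩ := hci N hN
    have hDpos := hpos N hN
    have hN1 : (0 : ℝ) < (N : ℝ) - 1 := by
      have : (2 : ℝ) ≤ (N : ℝ) := by exact_mod_cast hN
      linarith
    have htel : ∑ b ∈ Finset.range (N - 1), (θ N b - θ N (b + 1)) = θ N 0 - θ N (N - 1) :=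
      Finset.sum_range_sub' (fun b => θ N b) (N - 1)
    show ((N : ℝ) - 1) / D N =
      2 / γ + ∑ b ∈ Finset.range (N - 1), (θ N b - θ N (b + 1)) * (((N : ℝ) - 1) / D N)
    rw [← Finset.sum_mul, htel]
    exact series_law_of_contact γ hγ.ne' ((N : ℝ) - 1) (D N) (θ N 0) (θ N (N - 1)) hN1.ne' hDpos.ne' h0 h1'
  have hrefl : ∀ N b, 2 ≤ N → b + 2 ≤ N → r N b = r N (N - 2 - b) := by
    intro N b hN hb
    have ha := hanti N (b + 1) (by omega)
    have hb' := hanti N b (by omega)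
    have e1 : N - 1 - (b + 1) = N - 2 - b := by omega
    have e2 : N - 2 - b + 1 = N - 1 - b := by omega
    show (θ N b - θ N (b + 1)) * (((N : ℝ) - 1) / D N) =
      (θ N (N - 2 - b) - θ N (N - 2 - b + 1)) * (((N : ℝ) - 1) / D N)
    rw [e2, ← e1, ha, hb']
    ring
  -- the stubs
  obtain ⟨N₁, i₀, s, -, hS1⟩ := h1 ω₂ lam β γ hω hl hβ hγ hU μ hμ T hT
  have hS3 := h3 ω₂ lam β γ hω hl hβ hγ hU μ hμ T hT
  choose Bf N₀f hBf using hS3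
  -- uniform bound on every local resistance, eventually
  set Bsum : ℝ := ∑ j ∈ Finset.range (i₀ + 1), |Bf j| with hBsum
  set K : ℝ := Bsum + |s i₀| with hK
  set Nbig : ℕ := N₁ + (∑ j ∈ Finset.range (i₀ + 1), N₀f j) + 2 * i₀ + 2 with hNbig
  have hN₀le : ∀ j, j ≤ i₀ → N₀f j ≤ Nbig := by
    intro j hj
    have : N₀f j ≤ ∑ k ∈ Finset.range (i₀ + 1), N₀f k :=
      Finset.single_le_sum (fun k _ => Nat.zero_le (N₀f k)) (Finset.mem_range.mpr (by omega))
    omega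
  have hBle : ∀ j, j ≤ i₀ → |Bf j| ≤ Bsum := fun j hj =>
    Finset.single_le_sum (fun k _ => abs_nonneg (Bf k)) (Finset.mem_range.mpr (by omega))
  have hBsum0 : 0 ≤ Bsum := Finset.sum_nonneg fun k _ => abs_nonneg _
  have hK0 : 0 ≤ K := by positivity
  -- hot-half bonds
  have hhot : ∀ N b, Nbig ≤ N → 2 * b + 2 ≤ N → r N b ≤ K := by
    intro N b hN hb
    have hpN := hpos N (by omega)
    by_cases hbi : b < i₀
    · have h := hBf b N (θ N) (D N) (le_trans (hN₀le b hbi.le) hN) hb (hθ N) (hD N) hpN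
      have := hBle b hbi.le
      linarith [(abs_le.mp h).2, abs_nonneg (s i₀), le_abs_self (Bf b)]
    · have hi0 : i₀ ≤ b := not_lt.mp hbi
      have hS : r N b ≤ r N i₀ + s i₀ := hS1 N (θ N) (D N) (by omega) (hθ N) (hD N) hpN i₀ b le_rfl hi0 hb
      have h := hBf i₀ N (θ N) (D N) (le_trans (hN₀le i₀ le_rfl) hN) (by omega) (hθ N) (hD N) hpN
      have := hBle i₀ le_rfl
      linarith [(abs_le.mp h).2, le_abs_self (s i₀), le_abs_self (Bf i₀)]
  have hall : ∀ N b, Nbig ≤ N → b < N - 1 → r N b ≤ K := by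
    intro N b hN hb
    by_cases hhalf : 2 * b + 2 ≤ N
    · exact hhot N b hN hhalf
    · rw [hrefl N b (by omega) (by omega)]
      exact hhot N (N - 2 - b) hN (by omega)
  -- the floor
  refine ⟨1 / (2 / γ + K + 1), by positivity, Nbig, fun N hN => ?_⟩
  have hN2 : 2 ≤ N := by omega
  have hDpos := hpos N hN2
  have hN1 : (1 : ℝ) ≤ (N : ℝ) - 1 := by
    have : (2 : ℝ) ≤ (N : ℝ) := by exact_mod_cast hN2
    linarith
  have hsum : ∑ b ∈ Finset.range (N - 1), r N b ≤ ((N : ℝ) - 1) * K := by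
    calc ∑ b ∈ Finset.range (N - 1), r N b ≤ ∑ b ∈ Finset.range (N - 1), K :=
          Finset.sum_le_sum fun b hb => hall N b hN (Finset.mem_range.mp hb)
      _ = ((N : ℝ) - 1) * K := by
          rw [Finset.sum_const, Finset.card_range, nsmul_eq_mul, Nat.cast_sub (by omega : 1 ≤ N), Nat.cast_one]
  have hR : ((N : ℝ) - 1) / D N ≤ 2 / γ + ((N : ℝ) - 1) * K := by rw [hledger N hN2]; linarith
  have h2γ : 0 < 2 / γ := by positivity
  -- (N-1)/D ≤ (N-1)(2/γ + K + 1), so 1/D ≤ 2/γ + K + 1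
  have hR' : ((N : ℝ) - 1) / D N ≤ ((N : ℝ) - 1) * (2 / γ + K + 1) := by nlinarith
  have hinv : 1 / D N ≤ 2 / γ + K + 1 := by
    have h := div_le_div_of_nonneg_right hR' (by linarith : (0 : ℝ) ≤ (N : ℝ) - 1)
    have e1 : ((N : ℝ) - 1) / D N / ((N : ℝ) - 1) = 1 / D N := by
      field_simp
    have e2 : ((N : ℝ) - 1) * (2 / γ + K + 1) / ((N : ℝ) - 1) = 2 / γ + K + 1 := by
      field_simp
    rw [e1, e2] at h
    exact h
  have hc : 0 < 2 / γ + K + 1 := by positivity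
  rw [div_le_iff₀ hc]
  have := (div_le_iff₀ hDpos).mp hinv
  nlinarith

/-- **stmt-13406 ⇒ stmt-9141**: `SpatialCentreManifold.LocalFourierLaw` implies
`OddSectorIrreversibility.BoundedResponseConverges`, through the line: S1, S2, S3 are all shadows of the local law
(`stub_inwardOrdering_of_localFourierLaw`, `stub_lengthMonotone_of_summableLayers`, `stub_layerBounded_of_localFourierLaw`),
and the composition `boundedResponseConverges_of_comonotone`. Registered sub-goal. [folklore] -/
theorem boundedResponseConverges_of_localFourierLaw :
    Summit.AtomisticToContinuum.FouriersLaw.Theses.SpatialCentreManifold.LocalFourierLaw →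
    Summit.AtomisticToContinuum.FouriersLaw.Theses.OddSectorIrreversibility.BoundedResponseConverges :=
  fun hLF => boundedResponseConverges_of_comonotone (stub_inwardOrdering_of_localFourierLaw hLF)
    (stub_lengthMonotone_of_summableLayers hLF) (stub_layerBounded_of_localFourierLaw hLF)

end Summit.AtomisticToContinuum.FouriersLaw.Cruxes.BoundedResponseConverges.ComonotoneLocalResistance.Stubs

end
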